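import Summits.BirchSwinnertonDyer.Rank1Residual.X5.TwoAdicImageCriteria
import Literature.NumberTheory.EllipticCurves.TwoAdicImageSurjectivityProofs
import HarnessLib

/-!
# Class O1 (X5, `p = 2`): the mod-`8` lift is now a THEOREM — `SurjModEight W ↔ TwoAdicSurjective W`
# without the `hlift` binder

HONEST FRAMING (cell `b2b-bsdres`, run/shared/lean/b2b/bsd-rank1-residual/, verbatim in every
file): the goal of the cell is to DELETE the COMBINATION-SHAPED residual classes of the
Birch–Swinnerton-Dyer formula for ALL analytic-rank `≤ 1` elliptic curves over `ℚ` — "full BSD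
formula for every rank `≤ 1` curve in class `C`" assembled STRICTLY from published theorems — so
that the rank-`≤ 1` remainder becomes exactly the CONSTRUCTION-SHAPED classes, which are TYPED
(missing-input `Prop`s), NOT attempted. This is not "finishing BSD". Research routes; no claim
beyond stated classes; nothing here is booked; no mark of RESIDUAL-MAP §I moves; O1 stays OPEN.

Harvest seat 1 (`b2b-bsdres-harvest-1`, split `p = 2` / CM / supersingular), gen 28. Theorems only
(no definition, no named fact). The named fact
`Literature.NumberTheory.EllipticCurves.hasSurjectiveModNGaloisRep_two_pow_of_eight`
("`ρ̄_{E,8}` onto ⟹ `ρ̄_{E,2ⁿ}` onto", Rouse–Zureick-Brown 2015 §3 Lemma / §1) taken as the binder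
`hlift` by `X5/TwoAdicImageCriteria.lean` (cc-typer-4, item (21) of the o1 typer queue) is
DISCHARGED in the tree (`hasSurjectiveModNGaloisRep_two_pow_of_eight_holds`,
`Literature/NumberTheory/EllipticCurves/TwoAdicImageSurjectivityProofs.lean`: the elliptic-curve
glue `E[2ᴺ] ≅ (ℤ/2ᴺ)²` compatibly in `N` on top of the finite-level group theory
`GaloisRepresentations.surjective_of_surjective_castHom_eight_comp`). Hence:

* `twoAdicSurjective_of_surjModEight'` — `SurjModEight W → TwoAdicSurjective W`, NO binder;
* `surjModEight_of_twoAdicSurjective`, `twoAdicSurjective_iff_surjModEight` — the habitat binder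
  `TwoAdicSurjective W` of R1 / B3 / L3-14 IS the finite test `SurjModEight W` (`ρ̄_{E,8}` onto);
* `twoAdicSurjective_of_dokchitser'` — the per-curve discharge shape with the Dokchitser–Dokchitser
  criterion (`DokchitserDokchitser2012_surjective_mod_two_four_eight`, PUB) as the ONLY named input.

References: [RouseZureickbrown2015] §1, §3 Lemma; [DokchitserDokchitserMathZ2012] Theorem,
Introduction.
-/

set_option autoImplicit false

noncomputable section

open scoped Classical

open WeierstrassCurve Literature.NumberTheory.EllipticCurves

namespace Summit.BirchSwinnertonDyer.Rank1Residual.X5.O1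

variable (W : WeierstrassCurve ℚ) [W.IsElliptic]

/-- **`ρ̄_{E,8}` onto ⟹ `ρ_{E,2^∞}` onto, unconditionally**: `SurjModEight W → TwoAdicSurjective W`
(`twoAdicSurjective_of_surjModEight` with its `hlift` binder fed
`hasSurjectiveModNGaloisRep_two_pow_of_eight_holds`).
[cite: RouseZureickbrown2015, §3 Lemma and §1] [cite: DokchitserDokchitserMathZ2012, Introduction] -/
theorem twoAdicSurjective_of_surjModEight' (h8 : SurjModEight W) : TwoAdicSurjective W :=
  twoAdicSurjective_of_surjModEight W hasSurjectiveModNGaloisRep_two_pow_of_eight_holds h8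

omit [W.IsElliptic] in
/-- **`ρ_{E,2^∞}` onto ⟹ `ρ̄_{E,8}` onto** (the level `n = 3` of `TwoAdicSurjective`). [folklore] -/
theorem surjModEight_of_twoAdicSurjective (h : TwoAdicSurjective W) : SurjModEight W := by
  have h3 : W.HasSurjectiveModNGaloisRep ((2 : ℤ) ^ 3) := h 3 (by norm_num)
  have e : ((2 : ℤ) ^ 3) = 8 := by norm_num
  rw [e] at h3
  exact h3

/-- **The habitat binder is the finite test**: `TwoAdicSurjective W ↔ SurjModEight W`
(`ρ_{E,2^∞}` onto `GL₂(ℤ₂)` iff `ρ̄_{E,8}` onto `GL₂(ℤ/8)`; Rouse–Zureick-Brown 2015 §1 "whether the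
mod `8`, and thus the `2`-adic, image of Galois is surjective").
[cite: RouseZureickbrown2015, §3 Lemma and §1] -/
theorem twoAdicSurjective_iff_surjModEight : TwoAdicSurjective W ↔ SurjModEight W :=
  ⟨surjModEight_of_twoAdicSurjective W, twoAdicSurjective_of_surjModEight' W⟩

/-- **The habitat binder from PRINT, per curve, with ONE named input** (the Dokchitser–Dokchitser
criterion): no rational point of order `2`, `Δ, −Δ, 2Δ, −2Δ ∉ ℚ^{×2}`, `j ≠ −4t³(t + 8)` for all
`t ∈ ℚ` ⟹ `TwoAdicSurjective W`. [cite: DokchitserDokchitserMathZ2012, Theorem (p. 961)]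
[cite: RouseZureickbrown2015, §3 Lemma and §1] -/
theorem twoAdicSurjective_of_dokchitser'
    (hDD : DokchitserDokchitser2012_surjective_mod_two_four_eight)
    (h2 : ∀ P : W.toAffine.Point, 2 • P = 0 → P = 0) (hΔ : ¬ IsSquare W.Δ)
    (hΔ₁ : ¬ IsSquare (-W.Δ)) (hΔ₂ : ¬ IsSquare (2 * W.Δ)) (hΔ₃ : ¬ IsSquare (-2 * W.Δ))
    (hj : ∀ t : ℚ, W.j ≠ -4 * t ^ 3 * (t + 8)) : TwoAdicSurjective W :=
  twoAdicSurjective_of_dokchitser W hDD hasSurjectiveModNGaloisRep_two_pow_of_eight_holds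
    h2 hΔ hΔ₁ hΔ₂ hΔ₃ hj

end Summit.BirchSwinnertonDyer.Rank1Residual.X5.O1

end
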